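import Literature.MathematicalPhysics.QuantumLattice.FermionLiebRobinson
import HarnessLib

/-!
# Lieb–Robinson bounds for ANTIcommutators (odd observables of lattice fermions)

Companion of `FermionLiebRobinson.lean`. There the Hubbard Hamiltonian `H(t,U) − μN` on a finite
graph is shown to satisfy the commutator Lieb–Robinson bound
`‖[τ_s(A), B]‖ ≤ ‖[A, B]‖ + 2‖A‖ Σ_{Z ∩ X ≠ ∅} 2J‖B‖ s e^{2eJD s − ℓ(Z)}` for `A`, `B` in the CAR
algebras of the sites `X`, `Y`; for ODD observables (e.g. `A = c†_{xσ}`, `B = c_{yτ}`) this is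
empty, since `[A, B]` is not small — the graded (anti)commutator is. This file proves the
anticommutator form with the same light cone:

* `norm_anticomm_heisenbergEvolution_le` — the interaction-picture (Duhamel) inequality for
  anticommutators, `‖{τ_t^H(A), B}‖ ≤ ‖{A, B}‖ + 2‖A‖ |∫₀ᵗ ‖[τ_s^H(H − H'), B]‖ ds|` for `H'`
  commuting with `A` (same proof as the tree's `norm_comm_heisenbergEvolution_le`: conjugate to
  the interaction picture, where `{τ_t(A), B}` becomes `{A, G(t)}`);
* `lieb_robinson_anticomm_abstract` — for `H = Σ_Z h_Z` (Hermitian terms, `≤ D` terms touching a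
  term, `‖h_Z‖ ≤ J`, level function `ℓ`, as in `lieb_robinson_abstract`) and any `A` commuting with
  the terms outside `S`:
  `‖{τ_t(A), B}‖ ≤ ‖{A, B}‖ + 2‖A‖ Σ_{Z ∈ S} (2J‖B‖t + 4eJ²D‖B‖t²) e^{2eJD t − ℓ(Z)}`
  (Duhamel for `A`, then the tree's commutator bound `lieb_robinson_abstract` for each even term
  `h_Z`);
* `fermion_lieb_robinson_anticomm_hamiltonianWith` — the Hubbard model on a finite graph of
  maximal degree `≤ Δ`: for `A ∈ 𝔄_X`, `B ∈ 𝔄_Y` (no parity restriction is needed for the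
  HYPOTHESES — the Hamiltonian is even — the statement is useful when `{A, B}` is small, i.e. for
  odd `A`, `B`), `‖{τ_s(A), B}‖ ≤ ‖{A, B}‖ + 2‖A‖ Σ_{Z ∩ X ≠ ∅} (2Js + 4eJ²Ds²)‖B‖ e^{2eJDs − ℓ(Z)}`,
  `J = 2|t| + |U| + 2|μ|`, `D = 2(2Δ+1)`.

This is the fermionic Lieb–Robinson bound asked for by route `HubbardSuperconductivity/
ParityGapRigidity` (item `ParityGapClustering`: clustering of `⟨c†_{xσ} c_{yτ}⟩`).
Hastings–Koma, CMP 265 (2006) 781, App. A treat "quantum spin or fermion systems" uniformly with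
the graded commutator; Nachtergaele–Sims–Young, J. Math. Phys. 59 (2018) / Bru–de Siqueira Pedra
give the CAR-algebra formulation. No definitions.
-/

noncomputable section

namespace Literature.MathematicalPhysics.QuantumLattice

open Matrix Complex NormedSpace MeasureTheory intervalIntegral
open scoped Matrix.Norms.L2Operator

section Abstract

variable {n : Type*} [Fintype n] [DecidableEq n]

/-- **Interaction-picture identity for anticommutators.** If `H'` commutes with `A` then, with
`U = e^{itH} e^{−itH'}`, `{τ_t^H(A), B} = U {A, U⁻¹ B U} U⁻¹`. [folklore] -/
theorem anticomm_heisenbergEvolution_eq_conj {H H' A : Matrix n n ℂ} (hc : Commute H' A) (t : ℝ)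
    (B : Matrix n n ℂ) :
    heisenbergEvolution H t A * B + B * heisenbergEvolution H t A =
      (exp (t • (I • H)) * exp (t • (-(I • H')))) *
        (A * (exp (t • (I • H')) * exp (t • (-(I • H))) * B *
              (exp (t • (I • H)) * exp (t • (-(I • H'))))) +
          (exp (t • (I • H')) * exp (t • (-(I • H))) * B *
              (exp (t • (I • H)) * exp (t • (-(I • H'))))) * A) *
        (exp (t • (I • H')) * exp (t • (-(I • H)))) := by
  set E := exp (t • (I • H)) with hE
  set Em := exp (t • (-(I • H))) with hEm
  set F := exp (t • (I • H')) with hF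
  set Fm := exp (t • (-(I • H'))) with hFm
  have hEE : E * Em = 1 := exp_smul_mul_exp_smul_neg _ t
  have hEE' : Em * E = 1 := exp_smul_neg_mul_exp_smul _ t
  have hFF : F * Fm = 1 := exp_smul_mul_exp_smul_neg _ t
  have hFF' : Fm * F = 1 := exp_smul_neg_mul_exp_smul _ t
  have hA : F * A * Fm = A := exp_smul_mul_mul_exp_smul_neg_of_commute hc t
  have hA' : Fm * A * F = A := by
    calc Fm * A * F = Fm * (F * A * Fm) * F := by rw [hA]
      _ = (Fm * F) * A * (Fm * F) := by simp only [Matrix.mul_assoc]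
      _ = A := by rw [hFF', Matrix.one_mul, Matrix.mul_one]
  rw [heisenbergEvolution_eq_exp_smul]
  -- expand the right-hand side
  have h1 : E * Fm * (A * (F * Em * B * (E * Fm))) * (F * Em) = E * A * Em * B := by
    calc E * Fm * (A * (F * Em * B * (E * Fm))) * (F * Em)
        = E * (Fm * A * F) * (Em * B * E) * (Fm * F) * Em := by simp only [Matrix.mul_assoc]
      _ = E * A * Em * B := by
          rw [hA', hFF', Matrix.mul_one]
          calc E * A * (Em * B * E) * Em = E * A * Em * B * (E * Em) := by
                simp only [Matrix.mul_assoc]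
            _ = E * A * Em * B := by rw [hEE, Matrix.mul_one]
  have h2 : E * Fm * (F * Em * B * (E * Fm) * A) * (F * Em) = B * (E * A * Em) := by
    calc E * Fm * (F * Em * B * (E * Fm) * A) * (F * Em)
        = (E * (Fm * F) * Em) * B * E * (Fm * A * F) * Em := by simp only [Matrix.mul_assoc]
      _ = B * (E * A * Em) := by
          rw [hFF', Matrix.mul_one, hEE, Matrix.one_mul, hA']
          simp only [Matrix.mul_assoc]
  rw [Matrix.mul_add, Matrix.add_mul, h1, h2]

/-- **The Duhamel (interaction-picture) inequality for anticommutators.** Let `H`, `H'` be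
Hermitian with `H'` commuting with `A`. Then for every `B` and every time `t`,
`‖{τ_t^H(A), B}‖ ≤ ‖{A, B}‖ + 2‖A‖ |∫₀ᵗ ‖[τ_s^H(H − H'), B]‖ ds|` — the graded form of
Nachtergaele–Ogata–Sims / Hastings–Koma (A.7) for odd `A` and even `H − H'`.
[cite: HastingsKoma2006, App. A] -/
theorem norm_anticomm_heisenbergEvolution_le {H H' A : Matrix n n ℂ} (hH : H.IsHermitian)
    (hH' : H'.IsHermitian) (hc : Commute H' A) (B : Matrix n n ℂ) (t : ℝ) :
    ‖heisenbergEvolution H t A * B + B * heisenbergEvolution H t A‖ ≤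
      ‖A * B + B * A‖ + 2 * ‖A‖ *
        |∫ s in (0 : ℝ)..t,
          ‖heisenbergEvolution H s (H - H') * B - B * heisenbergEvolution H s (H - H')‖| := by
  -- the interaction-picture observable and its derivative
  set G : ℝ → Matrix n n ℂ := fun u => exp (u • (I • H')) * heisenbergEvolution H (-u) B *
    exp (u • (-(I • H'))) with hG
  set G' : ℝ → Matrix n n ℂ := fun u => -(exp (u • (I • H')) *
    ((I • H - I • H') * heisenbergEvolution H (-u) B -
      heisenbergEvolution H (-u) B * (I • H - I • H')) * exp (u • (-(I • H')))) with hG'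
  have hderiv : ∀ u, HasDerivAt G (G' u) u := fun u => hasDerivAt_interactionPicture H H' B u
  have hcont : Continuous G' := continuous_interactionPicture_deriv H H' B
  have hFTC : ∫ u in (0 : ℝ)..t, G' u = G t - G 0 :=
    integral_eq_sub_of_hasDerivAt (fun u _ => hderiv u) (hcont.intervalIntegrable 0 t)
  have hG0 : G 0 = B := by
    simp [hG]
  have hGt : G t = exp (t • (I • H')) * exp (t • (-(I • H))) * B *
      (exp (t • (I • H)) * exp (t • (-(I • H')))) := by
    simp only [hG, heisenbergEvolution_eq_exp_smul, neg_smul, smul_neg, neg_neg, Matrix.mul_assoc]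
  -- Step 1: `‖{τ_t A, B}‖ = ‖{A, G t}‖`
  have hU : exp (t • (I • H)) * exp (t • (-(I • H'))) ∈ unitary (Matrix n n ℂ) :=
    mul_mem (exp_smul_I_smul_mem_unitary hH t) (exp_smul_neg_I_smul_mem_unitary hH' t)
  have hV : exp (t • (I • H')) * exp (t • (-(I • H))) ∈ unitary (Matrix n n ℂ) :=
    mul_mem (exp_smul_I_smul_mem_unitary hH' t) (exp_smul_neg_I_smul_mem_unitary hH t)
  have hstep1 : ‖heisenbergEvolution H t A * B + B * heisenbergEvolution H t A‖ =
      ‖A * G t + G t * A‖ := by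
    rw [anticomm_heisenbergEvolution_eq_conj hc t B, norm_unitary_mul_mul_unitary hU hV, hGt]
  -- Step 2: `‖{A, G t}‖ ≤ ‖{A, B}‖ + 2‖A‖ ‖G t - G 0‖`
  have hstep2 : ‖A * G t + G t * A‖ ≤ ‖A * B + B * A‖ + 2 * ‖A‖ * ‖G t - G 0‖ := by
    have hsplit : A * G t + G t * A = (A * B + B * A) + (A * (G t - G 0) + (G t - G 0) * A) := by
      rw [hG0]; noncomm_ring
    rw [hsplit]
    refine (norm_add_le _ _).trans (add_le_add le_rfl ?_)
    calc ‖A * (G t - G 0) + (G t - G 0) * A‖ ≤ ‖A * (G t - G 0)‖ + ‖(G t - G 0) * A‖ :=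
          norm_add_le _ _
      _ ≤ ‖A‖ * ‖G t - G 0‖ + ‖G t - G 0‖ * ‖A‖ :=
          add_le_add (l2_opNorm_mul _ _) (l2_opNorm_mul _ _)
      _ = 2 * ‖A‖ * ‖G t - G 0‖ := by ring
  -- Step 3: `‖G t - G 0‖ ≤ |∫ ‖G'‖|` and `‖G' s‖` is the commutator norm
  have hstep3 : ‖G t - G 0‖ ≤ |∫ s in (0 : ℝ)..t,
      ‖heisenbergEvolution H s (H - H') * B - B * heisenbergEvolution H s (H - H')‖| := by
    rw [← hFTC]
    refine (norm_integral_le_abs_integral_norm).trans (le_of_eq ?_)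
    congr 1
    refine integral_congr fun s _ => ?_
    exact norm_interactionPicture_deriv hH hH' B s
  rw [hstep1]
  refine hstep2.trans (add_le_add le_rfl ?_)
  exact mul_le_mul_of_nonneg_left hstep3 (by positivity)

/-- **Abstract anticommutator Lieb–Robinson bound** for a finite sum `H = Σ_Z h_Z` of Hermitian
terms (combinatorial data exactly as in `lieb_robinson_abstract`: a relation `touch` outside of
which terms commute, `‖h_Z‖ ≤ J`, at most `D` terms touching a term, a level function `ℓ` with
`[h_Z, B] = 0` off level `0` dropping by `≤ 1` along touching terms, and a set `S` of terms outside
of which everything commutes with `A`): for `t ≥ 0`,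
`‖{τ_t(A), B}‖ ≤ ‖{A, B}‖ + 2‖A‖ Σ_{Z ∈ S} (2J‖B‖t + 4eJ²D‖B‖t²) e^{2eJD t − ℓ(Z)}`.
Proof: the anticommutator Duhamel inequality for `A` with `H' = Σ_{Z ∉ S} h_Z`, then the
commutator bound `lieb_robinson_abstract` for each (even) term `h_Z`, `Z ∈ S`.
[cite: HastingsKoma2006, App. A] -/
theorem lieb_robinson_anticomm_abstract {ι : Type*} [Fintype ι] [DecidableEq ι]
    (h : ι → Matrix n n ℂ) (hh : ∀ Z, (h Z).IsHermitian)
    (touch : ι → ι → Prop) [DecidableRel touch]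
    (htouch : ∀ Z Z', ¬ touch Z' Z → Commute (h Z') (h Z))
    {J : ℝ} (hJ0 : 0 ≤ J) (hJ : ∀ Z, ‖h Z‖ ≤ J) {D : ℕ}
    (hD : ∀ Z, (Finset.univ.filter fun Z' => touch Z' Z).card ≤ D)
    (B : Matrix n n ℂ) (ℓ : ι → ℕ) (hℓ0 : ∀ Z, ℓ Z ≠ 0 → Commute (h Z) B)
    (hℓ : ∀ Z Z', touch Z' Z → ℓ Z ≤ ℓ Z' + 1)
    (A : Matrix n n ℂ) (S : Finset ι) (hS : ∀ Z ∉ S, Commute (h Z) A)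
    {t : ℝ} (ht : 0 ≤ t) :
    ‖heisenbergEvolution (∑ Z, h Z) t A * B + B * heisenbergEvolution (∑ Z, h Z) t A‖ ≤
      ‖A * B + B * A‖ + 2 * ‖A‖ * ∑ Z ∈ S,
        (2 * J * ‖B‖ * t + 4 * Real.exp 1 * J ^ 2 * D * ‖B‖ * t ^ 2) *
          Real.exp (Real.exp 1 * (2 * J * D) * t - ℓ Z) := by
  set H : Matrix n n ℂ := ∑ Z, h Z with hHdef
  have hH : H.IsHermitian := isHermitian_finset_sum _ fun Z _ => hh Z
  set P : Matrix n n ℂ := ∑ Z ∈ S, h Z with hPdef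
  have hP : P.IsHermitian := isHermitian_finset_sum _ fun Z _ => hh Z
  have hHP : H - P = ∑ Z ∈ Sᶜ, h Z := by
    rw [hHdef, hPdef, ← Finset.sum_compl_add_sum S, add_sub_cancel_right]
  have hcomm : Commute (H - P) A := by
    rw [hHP]
    exact Commute.sum_left _ _ _ fun Z hZ => hS Z (Finset.mem_compl.1 hZ)
  -- the anticommutator Duhamel bound
  have hd := norm_anticomm_heisenbergEvolution_le hH (hH.sub hP) hcomm B t
  rw [sub_sub_cancel] at hd
  refine hd.trans (add_le_add le_rfl ?_)
  -- the light-cone rate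
  set c : ℝ := Real.exp 1 * (2 * J * D) with hcdef
  have hc0 : 0 ≤ c := by positivity
  -- pointwise bound of the integrand on `(0, t]`
  set M : ℝ := ∑ Z ∈ S, (2 * J * ‖B‖ + 4 * Real.exp 1 * J ^ 2 * D * ‖B‖ * t) *
    (Real.exp (c * t) * Real.exp (-(ℓ Z : ℝ))) with hMdef
  have hterm : ∀ Z : ι, ∀ s : ℝ, 0 ≤ s → s ≤ t →
      ‖heisenbergEvolution H s (h Z) * B - B * heisenbergEvolution H s (h Z)‖ ≤
        (2 * J * ‖B‖ + 4 * Real.exp 1 * J ^ 2 * D * ‖B‖ * t) *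
          (Real.exp (c * t) * Real.exp (-(ℓ Z : ℝ))) := by
    intro Z s hs hst
    have hlr := lieb_robinson_abstract h hh touch htouch hJ0 hJ hD B ℓ hℓ0 hℓ (h Z)
      (Finset.univ.filter fun Z' => touch Z' Z) (fun Z' hZ' => htouch Z Z' (by simpa using hZ')) hs
    refine hlr.trans ?_
    have hect : 1 ≤ Real.exp (c * t) := Real.one_le_exp (by positivity)
    -- first summand: `‖[h Z, B]‖ ≤ 2J‖B‖ e^{ct} e^{-ℓ Z}`
    have h1 : ‖h Z * B - B * h Z‖ ≤ 2 * J * ‖B‖ * (Real.exp (c * t) * Real.exp (-(ℓ Z : ℝ))) := by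
      by_cases hZ0 : ℓ Z = 0
      · rw [hZ0, Nat.cast_zero, neg_zero, Real.exp_zero, mul_one]
        calc ‖h Z * B - B * h Z‖ ≤ 2 * ‖h Z‖ * ‖B‖ := norm_commutator_le (h Z) B
          _ ≤ 2 * J * ‖B‖ := by gcongr; exact hJ Z
          _ ≤ 2 * J * ‖B‖ * Real.exp (c * t) := le_mul_of_one_le_right (by positivity) hect
      · rw [(hℓ0 Z hZ0).eq, sub_self, norm_zero]
        positivity
    -- second summand
    have h2 : 2 * ‖h Z‖ * ∑ Z' ∈ Finset.univ.filter (fun Z' => touch Z' Z),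
        2 * J * ‖B‖ * s * Real.exp (Real.exp 1 * (2 * J * D) * s - ℓ Z') ≤
        4 * Real.exp 1 * J ^ 2 * D * ‖B‖ * t * (Real.exp (c * t) * Real.exp (-(ℓ Z : ℝ))) := by
      have hsum : ∑ Z' ∈ Finset.univ.filter (fun Z' => touch Z' Z),
          2 * J * ‖B‖ * s * Real.exp (Real.exp 1 * (2 * J * D) * s - ℓ Z') ≤
          D * (2 * J * ‖B‖ * t * (Real.exp (c * t) * (Real.exp 1 * Real.exp (-(ℓ Z : ℝ))))) := by
        calc ∑ Z' ∈ Finset.univ.filter (fun Z' => touch Z' Z),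
              2 * J * ‖B‖ * s * Real.exp (Real.exp 1 * (2 * J * D) * s - ℓ Z')
            ≤ ∑ _Z' ∈ Finset.univ.filter (fun Z' => touch Z' Z),
                2 * J * ‖B‖ * t * (Real.exp (c * t) * (Real.exp 1 * Real.exp (-(ℓ Z : ℝ)))) := by
              refine Finset.sum_le_sum fun Z' hZ' => ?_
              have htZ : touch Z' Z := by simpa using hZ'
              have hl : (ℓ Z : ℝ) ≤ ℓ Z' + 1 := by exact_mod_cast hℓ Z Z' htZ
              rw [← hcdef, Real.exp_sub]
              have hexp1 : Real.exp (c * s) ≤ Real.exp (c * t) :=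
                Real.exp_le_exp.2 (mul_le_mul_of_nonneg_left hst hc0)
              have hexp2 : Real.exp (-(ℓ Z' : ℝ)) ≤ Real.exp 1 * Real.exp (-(ℓ Z : ℝ)) := by
                rw [← Real.exp_add]
                exact Real.exp_le_exp.2 (by linarith)
              have hexp2' : Real.exp (c * s) / Real.exp (ℓ Z' : ℝ) ≤
                  Real.exp (c * t) * (Real.exp 1 * Real.exp (-(ℓ Z : ℝ))) := by
                rw [div_eq_mul_inv, ← Real.exp_neg]
                exact mul_le_mul hexp1 hexp2 (by positivity) (by positivity)
              calc 2 * J * ‖B‖ * s * (Real.exp (c * s) / Real.exp (ℓ Z' : ℝ))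
                  ≤ 2 * J * ‖B‖ * t * (Real.exp (c * s) / Real.exp (ℓ Z' : ℝ)) := by
                    gcongr
                _ ≤ 2 * J * ‖B‖ * t * (Real.exp (c * t) * (Real.exp 1 * Real.exp (-(ℓ Z : ℝ)))) :=
                    mul_le_mul_of_nonneg_left hexp2' (by positivity)
          _ = (Finset.univ.filter (fun Z' => touch Z' Z)).card *
                (2 * J * ‖B‖ * t * (Real.exp (c * t) * (Real.exp 1 * Real.exp (-(ℓ Z : ℝ))))) := by
              rw [Finset.sum_const, nsmul_eq_mul]
          _ ≤ D * (2 * J * ‖B‖ * t * (Real.exp (c * t) * (Real.exp 1 * Real.exp (-(ℓ Z : ℝ))))) := by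
              gcongr
              exact_mod_cast hD Z
      calc 2 * ‖h Z‖ * ∑ Z' ∈ Finset.univ.filter (fun Z' => touch Z' Z),
            2 * J * ‖B‖ * s * Real.exp (Real.exp 1 * (2 * J * D) * s - ℓ Z')
          ≤ 2 * J * (D * (2 * J * ‖B‖ * t * (Real.exp (c * t) * (Real.exp 1 * Real.exp (-(ℓ Z : ℝ)))))) :=
            mul_le_mul (by linarith [hJ Z]) hsum (Finset.sum_nonneg fun _ _ => by positivity)
              (by positivity)
        _ = 4 * Real.exp 1 * J ^ 2 * D * ‖B‖ * t * (Real.exp (c * t) * Real.exp (-(ℓ Z : ℝ))) := by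
            ring
    calc ‖h Z * B - B * h Z‖ + 2 * ‖h Z‖ * ∑ Z' ∈ Finset.univ.filter (fun Z' => touch Z' Z),
          2 * J * ‖B‖ * s * Real.exp (Real.exp 1 * (2 * J * D) * s - ℓ Z')
        ≤ 2 * J * ‖B‖ * (Real.exp (c * t) * Real.exp (-(ℓ Z : ℝ))) +
          4 * Real.exp 1 * J ^ 2 * D * ‖B‖ * t * (Real.exp (c * t) * Real.exp (-(ℓ Z : ℝ))) :=
          add_le_add h1 h2
      _ = _ := by ring
  have hpt : ∀ s ∈ Set.uIoc (0 : ℝ) t,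
      ‖(‖heisenbergEvolution H s P * B - B * heisenbergEvolution H s P‖ : ℝ)‖ ≤ M := by
    intro s hs
    rw [Set.uIoc_of_le ht] at hs
    rw [Real.norm_eq_abs, abs_of_nonneg (norm_nonneg _), hPdef, heisenbergEvolution_finset_sum,
      finset_sum_commutator]
    refine (norm_sum_le _ _).trans ?_
    rw [hMdef]
    exact Finset.sum_le_sum fun Z _ => hterm Z s hs.1.le hs.2
  have hint : |∫ s in (0 : ℝ)..t,
      ‖heisenbergEvolution H s P * B - B * heisenbergEvolution H s P‖| ≤ M * t := by
    have := intervalIntegral.norm_integral_le_of_norm_le_const hpt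
    rw [Real.norm_eq_abs, sub_zero, abs_of_nonneg ht] at this
    exact this
  calc 2 * ‖A‖ * |∫ s in (0 : ℝ)..t,
        ‖heisenbergEvolution H s P * B - B * heisenbergEvolution H s P‖|
      ≤ 2 * ‖A‖ * (M * t) := mul_le_mul_of_nonneg_left hint (by positivity)
    _ = 2 * ‖A‖ * ∑ Z ∈ S, (2 * J * ‖B‖ * t + 4 * Real.exp 1 * J ^ 2 * D * ‖B‖ * t ^ 2) *
          Real.exp (Real.exp 1 * (2 * J * D) * t - ℓ Z) := by
        rw [hMdef, Finset.sum_mul]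
        congr 1
        refine Finset.sum_congr rfl fun Z _ => ?_
        rw [Real.exp_sub, ← hcdef, div_eq_mul_inv, ← Real.exp_neg]
        ring

end Abstract

section FermionHubbard

variable {Λ : Type*} [LinearOrder Λ] [Fintype Λ] (G : SimpleGraph Λ) [DecidableRel G.Adj]

/-- **Anticommutator Lieb–Robinson bound for the Hubbard model on a finite graph (odd
observables of lattice fermions).** Let `G` have maximal degree `≤ Δ`, let `A` lie in the CAR
algebra of the sites `X` and `B` in that of the sites `Y`, and let `δ : Λ → ℕ` vanish on `Y` and
change by at most one across an edge. Then for `s ≥ 0`, with `J = 2|t| + |U| + 2|μ|`,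
`D = 2(2Δ + 1)`:
`‖{τ_s(A), B}‖ ≤ ‖{A, B}‖ + 2‖A‖ Σ_{Z : supp Z ∩ X ≠ ∅} (2J‖B‖s + 4eJ²D‖B‖s²) e^{2eJD s − ℓ(Z)}`,
`ℓ(Z) = min_{z ∈ supp Z} δ(z)`. For odd `A`, `B` at distance (`{A, B} = 0`) this is the
fermionic light cone behind the clustering of `⟨c†_{xσ} c_{yτ}⟩`. (`lieb_robinson_anticomm_abstract`
for the even finite-range interaction `hubbardTermOp`, graded locality from
`commute_of_mem_carEvenSubalgebra`.) [cite: HastingsKoma2006, App. A] -/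
theorem fermion_lieb_robinson_anticomm_hamiltonianWith {Δ : ℕ}
    (hΔ : ∀ x : Λ, (Finset.univ.filter fun y => G.Adj x y).card ≤ Δ) (t U μ : ℝ)
    {X Y : Finset Λ} {A B : Matrix (Finset (Orb Λ)) (Finset (Orb Λ)) ℂ}
    (hA : A ∈ carSubalgebra (orbSet X)) (hB : B ∈ carSubalgebra (orbSet Y))
    (δ : Λ → ℕ) (hδY : ∀ y ∈ Y, δ y = 0) (hδ : ∀ x y, G.Adj x y → δ x ≤ δ y + 1)
    {s : ℝ} (hs : 0 ≤ s) :
    ‖heisenbergEvolution (hamiltonianWith G t U μ) s A * B + B * heisenbergEvolution (hamiltonianWith G t U μ) s A‖ ≤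
      ‖A * B + B * A‖ + 2 * ‖A‖ *
        ∑ Z ∈ Finset.univ.filter (fun Z : HubbardIdx G => ¬ Disjoint (hubbardTermSupp G Z) X),
          (2 * (2 * |t| + |U| + 2 * |μ|) * ‖B‖ * s +
              4 * Real.exp 1 * (2 * |t| + |U| + 2 * |μ|) ^ 2 * (2 * (2 * Δ + 1) : ℕ) * ‖B‖ * s ^ 2) *
            Real.exp (Real.exp 1 * (2 * (2 * |t| + |U| + 2 * |μ|) * (2 * (2 * Δ + 1) : ℕ)) * s -
              ((hubbardTermSupp G Z).inf' (hubbardTermSupp_nonempty G Z) δ : ℕ)) := by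
  classical
  rw [← sum_hubbardTermOp G t U μ]
  refine lieb_robinson_anticomm_abstract (hubbardTermOp G t U μ) (isHermitian_hubbardTermOp G t U μ)
    (fun Z' Z => ¬ Disjoint (hubbardTermSupp G Z') (hubbardTermSupp G Z)) ?_
    (by positivity) (norm_hubbardTermOp_le G t U μ) ?_ B
    (fun Z => (hubbardTermSupp G Z).inf' (hubbardTermSupp_nonempty G Z) δ) ?_ ?_ A _ ?_ hs
  · intro Z Z' hZZ'
    rw [not_not] at hZZ'
    exact commute_hubbardTermOp_of_disjoint G t U μ Z'
      ((carEvenSubalgebra_le_carSubalgebra _) (hubbardTermOp_mem_carEvenSubalgebra G t U μ Z)) hZZ'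
  · intro Z
    refine (card_filter_not_disjoint_hubbardTermSupp_le G hΔ _).trans ?_
    have hcard : (hubbardTermSupp G Z).card ≤ 2 := by
      cases Z with
      | inl p => exact Finset.card_insert_le _ _ |>.trans (by simp)
      | inr x => simp [hubbardTermSupp]
    calc (hubbardTermSupp G Z).card * (2 * Δ + 1) ≤ 2 * (2 * Δ + 1) := Nat.mul_le_mul_right _ hcard
      _ = (2 * (2 * Δ + 1) : ℕ) := rfl
  · intro Z hZ
    refine commute_hubbardTermOp_of_disjoint G t U μ Z hB (Finset.disjoint_left.2 fun z hzZ hzY => hZ ?_)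
    exact Nat.eq_zero_of_le_zero ((Finset.inf'_le δ hzZ).trans (hδY z hzY).le)
  · intro Z Z' hZZ'
    obtain ⟨w, hwZ', hwZ⟩ := Finset.not_disjoint_iff.1 hZZ'
    obtain ⟨z', hz', hmin⟩ := Finset.exists_mem_eq_inf' (hubbardTermSupp_nonempty G Z') δ
    rw [hmin]
    refine (Finset.inf'_le δ hwZ).trans ?_
    rcases eq_or_adj_of_mem_hubbardTermSupp G hwZ' hz' with h | h
    · rw [h]; exact Nat.le_succ _
    · exact hδ w z' h
  · intro Z hZ
    rw [Finset.mem_filter, not_and, not_not] at hZ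
    exact commute_hubbardTermOp_of_disjoint G t U μ Z hA (hZ (Finset.mem_univ _))

end FermionHubbard

end Literature.MathematicalPhysics.QuantumLattice
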